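import Literature.Analysis.FluidPDE.LocalLerayDifferenceEnergy
import Literature.Analysis.FluidPDE.UnitBallCovering
import HarnessLib

/-!
# The estimates of the tested inequality for the difference: the two elementary terms, and the
reduction of the right-hand estimate to the pressure and transport estimates

Analysis/FluidPDE proof file (theorems only), third layer of the DAG below the named fact
`Literature.Analysis.FluidPDE.local_leray_weak_strong_uniqueness` (**U**; P. G. Lemarié-Rieusset,
*The Navier–Stokes Problem in the 21st Century* (2016), Thm. 14.7). The second layer
(`LocalLerayDifferenceEnergy.lean`) proved **U₁** (`local_leray_difference_energy_estimate`)
from two hypotheses stated over `LemarieRieusset2016.WeakStrongSetting`: the tested local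
energy inequality for `w = u₁ - u₂` (part 1 of the printed proof, pp. 515–516) and the estimate
of its six-term right-hand side `differenceEnergyRHS` for the translates `φ(· - x₀)` of a bump
(part 2, pp. 516–517). The printed estimates of part 2 (file p. 517) are of three kinds:

1. *elementary*: the Laplacian term "`ν∫₀ᵗ∫(Δφ)|w|²/2 ≤ Cν∫₀ᵗα²(s)ds`" and the cubic transport
   term "`-∫₀ᵗ∫(w·∇φ)|w|²/2 ≤ Cδ(t)³`" (bounded derivatives of the bump, supported in a ball
   `B(x₀,R)`, and the comparison of the uniformly local quantities at the scales `R` and `1`);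
   these are **proved** here (`exists_laplacianTerm_le`, `exists_cubicTerm_le`, with the
   covering lemma of `UnitBallCovering.lean` and the translate bounds of
   `LocalLerayDifferenceEnergy.lean`);
2. *the pressure*: "`∫₀ᵗ∫(w·∇φ)(R₁ + R₂) ≤ Cδ(t)³`", "`∫₀ᵗ∫(w·∇φ)(S₁ + S₂) ≤ C∫₀ᵗ‖u₃‖_∞α² +
   C‖u₄‖γ(γ² + ∫₀ᵗα²)^{1/2}`" for the local pressure `q_{x₀} = R₁ + R₂ + S₁ + S₂` (p. 516:
   `R₁ = -(1/Δ)∇⊗∇(1_{B(x₀,5R₀)} w⊗w)`, `R₂` the far-field integral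
   `∫_{|y-x₀|>5R₀}(𝕂(x-y) - 𝕂(x₀-y)) w⊗w dy`, `S₁`, `S₂` the same for `u₁⊗w + w⊗u₁`) — the deep
   part (the local pressure expansion of local Leray solutions, Kang–Miura–Tsai 2021, Lemma 3.4
   for the tree's class, and Calderón–Zygmund / kernel bounds); it enters below as the
   hypothesis `hP`;
3. *transport and stretching by `u₁ = u₃ + u₄`*: "`∫₀ᵗ∫(w·∇φ)(u₁·w) ≤ C∫₀ᵗ‖u₃‖_∞α² + C‖u₄‖γ(γ²
   + ∫₀ᵗα²)^{1/2}`", "`∫₀ᵗ∫(u₁·∇φ)|w|²/2 ≤ C∫₀ᵗ‖u₃‖_∞α² + C‖u₄‖(γ² + ∫₀ᵗα²)`",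
   "`-∫₀ᵗ∫φu₁·(w·∇w) ≤ Cγ(∫₀ᵗ‖u₃‖²_∞α²)^{1/2} + C‖u₄‖γ(γ² + ∫₀ᵗα²)^{1/2}`" (Hölder's inequality,
   the Sobolev embedding on balls for `‖u₄‖_{L³}‖w‖_{L⁶}`, Cauchy–Schwarz in time); it enters
   below as the hypothesis `hN` (to be proved with the tree's Sobolev-on-balls tools).

The reduction `local_leray_difference_rhs_estimate_of : hP → hN → (part 2)` is **proved**
(six-term bookkeeping), and composed with the second layer:
`local_leray_difference_energy_estimate_of_pressure_transport : (part 1) → hP → hN → U₁`.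
No statement is introduced as a named fact (D-0026; `provefact` seat): all hypotheses are
inline.

## Rendering (design notes)

As in the second layer: constants depend on the bump `φ` only; `‖u₃(s)‖_∞` is the majorant
`m(s)`, `‖u₄‖_{L^∞𝒱̄¹}` the `L³` bound `ε`; the `u₄`-bounds are in the merged weaker form
`Cε(γ² + ∫α²)`; every integral is over `(0,t) × ℝ³` for `t ∈ (0,T]`, the pressure term being the
Bochner pairing of `differenceEnergyRHS` (integrable in the setting,
`LemarieRieusset2016.WeakStrongSetting.integrable_pressure_pairing`) and the other terms lower
integrals of absolute values.

## References

* P. G. Lemarié-Rieusset, *The Navier–Stokes Problem in the 21st Century*, CRC Press 2016,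
  doi:10.1201/b19556 (held copy): proof of Thm. 14.7, file pp. 516–517. [LemarieRieusset2016]
* K. Kang, H. Miura, T.-P. Tsai, IMRN 2021 = arXiv:1812.10509, Lemma 3.4. [KangMiuraTsai2020]
-/


noncomputable section

open MeasureTheory TopologicalSpace Set Function Filter Topology Metric
open scoped ENNReal NNReal RealInnerProductSpace Laplacian

namespace Literature.Analysis.FluidPDE

/-! ## Unit cylinders against `∫₀ᵗ α²` -/

/-- **Unit-cylinder energies of a difference against `∫₀ᵗ α(s)² ds`**: for two fields measurable
on the strip `(0,T) × ℝ³`, `t ≤ T` and every centre `y`,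
`∫₀ᵗ∫_{B(y,1)} |u₁ - u₂|² ≤ ∫₀ᵗ ulocEnergy (u₁ s - u₂ s) ds` (Tonelli and the definition of the
uniformly local energy). [folklore] -/
theorem lintegral_cylinder_sq_le_lintegral_ulocEnergy {T t : ℝ} {u₁ u₂ : ℝ → (EuclideanSpace ℝ (Fin 3)) → (EuclideanSpace ℝ (Fin 3))}
    (h₁ : AEStronglyMeasurable (uncurry u₁) (volume.restrict (Ioo 0 T ×ˢ (univ : Set (EuclideanSpace ℝ (Fin 3))))))
    (h₂ : AEStronglyMeasurable (uncurry u₂) (volume.restrict (Ioo 0 T ×ˢ (univ : Set (EuclideanSpace ℝ (Fin 3))))))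
    (ht : t ≤ T) (y : (EuclideanSpace ℝ (Fin 3))) :
    ∫⁻ z in Ioo 0 t ×ˢ ball y 1, ‖u₁ z.1 z.2 - u₂ z.1 z.2‖ₑ ^ 2 ≤
      ∫⁻ s in Ioo 0 t, ulocEnergy (u₁ s - u₂ s) := by
  have hprod : (volume.restrict (Ioo (0 : ℝ) t ×ˢ ball y 1) : Measure (ℝ × (EuclideanSpace ℝ (Fin 3)))) =
      ((volume : Measure ℝ).restrict (Ioo 0 t)).prod ((volume : Measure (EuclideanSpace ℝ (Fin 3))).restrict (ball y 1)) := by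
    rw [Measure.prod_restrict, ← Measure.volume_eq_prod]
  set w : ℝ → (EuclideanSpace ℝ (Fin 3)) → (EuclideanSpace ℝ (Fin 3)) := fun s x => u₁ s x - u₂ s x with hw
  have hmw : AEStronglyMeasurable (uncurry w)
      (((volume : Measure ℝ).restrict (Ioo 0 t)).prod ((volume : Measure (EuclideanSpace ℝ (Fin 3))).restrict (ball y 1))) := by
    rw [← hprod]
    exact (h₁.sub h₂).mono_measure
      (Measure.restrict_mono (prod_mono (Ioo_subset_Ioo_right ht) (subset_univ _)) le_rfl)
  calc ∫⁻ z in Ioo 0 t ×ˢ ball y 1, ‖u₁ z.1 z.2 - u₂ z.1 z.2‖ₑ ^ 2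
      = ∫⁻ z, ‖uncurry w z‖ₑ ^ 2
          ∂(((volume : Measure ℝ).restrict (Ioo 0 t)).prod ((volume : Measure (EuclideanSpace ℝ (Fin 3))).restrict (ball y 1))) := by
        rw [← hprod]
        rfl
    _ = ∫⁻ s in Ioo 0 t, ∫⁻ x in ball y 1, ‖w s x‖ₑ ^ 2 := lintegral_prod _ (hmw.enorm.pow_const 2)
    _ ≤ ∫⁻ s in Ioo 0 t, ulocEnergy (u₁ s - u₂ s) :=
        lintegral_mono fun s => lintegral_ball_le_ulocEnergy (u₁ s - u₂ s) y

/-! ## The two elementary terms -/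

/-- **The Laplacian term** (Lemarié-Rieusset 2016, p. 517, first estimate:
"`ν∫₀ᵗ∫(Δφ)|w|²/2 dx ds ≤ Cν∫₀ᵗα²(s) ds`"): for `φ ∈ C_c^∞(ℝ³)` there is `C = C(φ) ≥ 0` with
`∫₀ᵗ∫ (ν/2)|Δ(φ(· - x₀))||u₁ - u₂|² ≤ ν C ∫₀ᵗ α(s)² ds` for every setting, centre `x₀` and
`t ∈ (0,T]` (`|Δφ| ≤ B 1_{B(x₀,R)}`, the covering of `B(x₀,R)` by boundedly many unit balls,
Tonelli). [cite: LemarieRieusset2016, Thm. 14.7, proof (file p. 517, first estimate)] -/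
theorem exists_laplacianTerm_le {φ : (EuclideanSpace ℝ (Fin 3)) → ℝ} (hφ : FunctionSpaces.IsTestFunctionOn (⊤ : Opens (EuclideanSpace ℝ (Fin 3))) φ) :
    ∃ C : ℝ, 0 ≤ C ∧ ∀ {ν T : ℝ} {u₀ : (EuclideanSpace ℝ (Fin 3)) → (EuclideanSpace ℝ (Fin 3))} {u₁ u₂ : ℝ → (EuclideanSpace ℝ (Fin 3)) → (EuclideanSpace ℝ (Fin 3))} {p₁ p₂ : ℝ → (EuclideanSpace ℝ (Fin 3)) → ℝ}
      {u₃ u₄ : ℝ → (EuclideanSpace ℝ (Fin 3)) → (EuclideanSpace ℝ (Fin 3))} {m : ℝ → ℝ} {ε : ℝ} {G₁ G₂ : ℝ → (EuclideanSpace ℝ (Fin 3)) → (EuclideanSpace ℝ (Fin 3)) →L[ℝ] (EuclideanSpace ℝ (Fin 3))},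
      LemarieRieusset2016.WeakStrongSetting ν T u₀ u₁ u₂ p₁ p₂ u₃ u₄ m ε G₁ G₂ →
      ∀ (x₀ : (EuclideanSpace ℝ (Fin 3))) (t : ℝ), t ∈ Ioc 0 T →
        ∫⁻ z in Ioo 0 t ×ˢ (univ : Set (EuclideanSpace ℝ (Fin 3))),
            ENNReal.ofReal (ν / 2) * ‖(Δ fun x => φ (x - x₀)) z.2‖ₑ *
              ‖u₁ z.1 z.2 - u₂ z.1 z.2‖ₑ ^ 2 ≤
          ENNReal.ofReal ν * ENNReal.ofReal C * ∫⁻ s in Ioo 0 t, ulocEnergy (u₁ s - u₂ s) := by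
  obtain ⟨R, B, hR, hB, hbd⟩ := exists_testFunction_translate_bounds hφ
  obtain ⟨N, hN⟩ := exists_lintegral_cylinder_le_mul_iSup (T := ℝ) (E := (EuclideanSpace ℝ (Fin 3))) R
  refine ⟨B / 2 * N, by positivity, ?_⟩
  intro ν T u₀ u₁ u₂ p₁ p₂ u₃ u₄ m ε G₁ G₂ hS x₀ t ht
  have hν := hS.viscosity_pos
  set g : ℝ × (EuclideanSpace ℝ (Fin 3)) → ℝ≥0∞ := fun z => ‖u₁ z.1 z.2 - u₂ z.1 z.2‖ₑ ^ 2 with hg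
  have hmeas : MeasurableSet (Ioo (0 : ℝ) t ×ˢ ball x₀ R) := measurableSet_Ioo.prod measurableSet_ball
  -- pointwise bound on the strip
  have hpt : ∀ z ∈ Ioo (0 : ℝ) t ×ˢ (univ : Set (EuclideanSpace ℝ (Fin 3))),
      ENNReal.ofReal (ν / 2) * ‖(Δ fun x => φ (x - x₀)) z.2‖ₑ * g z ≤
        (Ioo (0 : ℝ) t ×ˢ ball x₀ R).indicator (fun z => ENNReal.ofReal (ν / 2 * B) * g z) z := by
    intro z hz
    by_cases hzR : z.2 ∈ ball x₀ R
    · rw [indicator_of_mem (show z ∈ Ioo (0 : ℝ) t ×ˢ ball x₀ R from ⟨hz.1, hzR⟩)]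
      refine mul_le_mul_left ?_ _
      rw [ENNReal.ofReal_mul (by positivity : (0 : ℝ) ≤ ν / 2)]
      refine mul_le_mul_right ?_ _
      rw [Real.enorm_eq_ofReal_abs]
      exact ENNReal.ofReal_le_ofReal (hbd x₀ z.2).2.2.1
    · have h0 : (Δ fun x => φ (x - x₀)) z.2 = 0 := ((hbd x₀ z.2).2.2.2 hzR).2.2
      rw [h0, enorm_zero, mul_zero, zero_mul]
      exact bot_le
  have hcyl : ∀ y : (EuclideanSpace ℝ (Fin 3)), ∫⁻ z in Ioo 0 t ×ˢ ball y 1, g z ≤ ∫⁻ s in Ioo 0 t, ulocEnergy (u₁ s - u₂ s) :=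
    fun y => lintegral_cylinder_sq_le_lintegral_ulocEnergy hS.sol₁.aestronglyMeasurable
      hS.sol₂.aestronglyMeasurable ht.2 y
  calc ∫⁻ z in Ioo 0 t ×ˢ (univ : Set (EuclideanSpace ℝ (Fin 3))),
          ENNReal.ofReal (ν / 2) * ‖(Δ fun x => φ (x - x₀)) z.2‖ₑ * g z
      ≤ ∫⁻ z in Ioo 0 t ×ˢ (univ : Set (EuclideanSpace ℝ (Fin 3))),
          (Ioo (0 : ℝ) t ×ˢ ball x₀ R).indicator (fun z => ENNReal.ofReal (ν / 2 * B) * g z) z :=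
        setLIntegral_mono' (measurableSet_Ioo.prod MeasurableSet.univ) hpt
    _ = ∫⁻ z in Ioo 0 t ×ˢ ball x₀ R, ENNReal.ofReal (ν / 2 * B) * g z := by
        rw [lintegral_indicator hmeas, Measure.restrict_restrict hmeas,
          inter_eq_left.2 (prod_mono Subset.rfl (subset_univ _))]
    _ = ENNReal.ofReal (ν / 2 * B) * ∫⁻ z in Ioo 0 t ×ˢ ball x₀ R, g z :=
        lintegral_const_mul' _ _ ENNReal.ofReal_ne_top
    _ ≤ ENNReal.ofReal (ν / 2 * B) * (N * ⨆ y : (EuclideanSpace ℝ (Fin 3)), ∫⁻ z in Ioo 0 t ×ˢ ball y 1, g z) :=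
        mul_le_mul_right (hN volume (Ioo 0 t) g x₀) _
    _ ≤ ENNReal.ofReal (ν / 2 * B) * (N * ∫⁻ s in Ioo 0 t, ulocEnergy (u₁ s - u₂ s)) := by
        gcongr
        exact iSup_le hcyl
    _ = ENNReal.ofReal ν * ENNReal.ofReal (B / 2 * N) * ∫⁻ s in Ioo 0 t, ulocEnergy (u₁ s - u₂ s) := by
        rw [show ν / 2 * B = ν * (B / 2) by ring, ENNReal.ofReal_mul hν.le,
          ENNReal.ofReal_mul (by positivity : (0 : ℝ) ≤ B / 2), ENNReal.ofReal_coe_nnreal]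
        ring

/-- **The cubic transport term** (Lemarié-Rieusset 2016, p. 517, second estimate:
"`-∫₀ᵗ∫(w·∇φ)|w|²/2 dx ds ≤ Cδ(t)³`"): for `φ ∈ C_c^∞(ℝ³)` there is `C = C(φ) ≥ 0` with
`∫₀ᵗ∫ ½|u₁ - u₂|²|⟨u₁ - u₂, ∇(φ(· - x₀))⟩| ≤ C δ(t)³`, `δ³ = ulocCubicOn t (u₁ - u₂)`, for every
setting, centre `x₀` and `t` (`|⟨w,∇φ⟩| ≤ B|w| 1_{B(x₀,R)}` and the covering of `B(x₀,R)` by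
boundedly many unit balls). [cite: LemarieRieusset2016, Thm. 14.7, proof (file p. 517, second estimate)] -/
theorem exists_cubicTerm_le {φ : (EuclideanSpace ℝ (Fin 3)) → ℝ} (hφ : FunctionSpaces.IsTestFunctionOn (⊤ : Opens (EuclideanSpace ℝ (Fin 3))) φ) :
    ∃ C : ℝ, 0 ≤ C ∧ ∀ {ν T : ℝ} {u₀ : (EuclideanSpace ℝ (Fin 3)) → (EuclideanSpace ℝ (Fin 3))} {u₁ u₂ : ℝ → (EuclideanSpace ℝ (Fin 3)) → (EuclideanSpace ℝ (Fin 3))} {p₁ p₂ : ℝ → (EuclideanSpace ℝ (Fin 3)) → ℝ}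
      {u₃ u₄ : ℝ → (EuclideanSpace ℝ (Fin 3)) → (EuclideanSpace ℝ (Fin 3))} {m : ℝ → ℝ} {ε : ℝ} {G₁ G₂ : ℝ → (EuclideanSpace ℝ (Fin 3)) → (EuclideanSpace ℝ (Fin 3)) →L[ℝ] (EuclideanSpace ℝ (Fin 3))},
      LemarieRieusset2016.WeakStrongSetting ν T u₀ u₁ u₂ p₁ p₂ u₃ u₄ m ε G₁ G₂ →
      ∀ (x₀ : (EuclideanSpace ℝ (Fin 3))) (t : ℝ), t ∈ Ioc 0 T →
        ∫⁻ z in Ioo 0 t ×ˢ (univ : Set (EuclideanSpace ℝ (Fin 3))),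
            2⁻¹ * ‖u₁ z.1 z.2 - u₂ z.1 z.2‖ₑ ^ 2 *
              ‖⟪u₁ z.1 z.2 - u₂ z.1 z.2, gradient (fun x => φ (x - x₀)) z.2⟫‖ₑ ≤
          ENNReal.ofReal C * ulocCubicOn t (u₁ - u₂) := by
  obtain ⟨R, B, hR, hB, hbd⟩ := exists_testFunction_translate_bounds hφ
  obtain ⟨N, hN⟩ := exists_lintegral_cylinder_le_mul_iSup (T := ℝ) (E := (EuclideanSpace ℝ (Fin 3))) R
  refine ⟨B / 2 * N, by positivity, ?_⟩
  intro ν T u₀ u₁ u₂ p₁ p₂ u₃ u₄ m ε G₁ G₂ _hS x₀ t _ht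
  set g : ℝ × (EuclideanSpace ℝ (Fin 3)) → ℝ≥0∞ := fun z => ‖u₁ z.1 z.2 - u₂ z.1 z.2‖ₑ ^ 3 with hg
  have hmeas : MeasurableSet (Ioo (0 : ℝ) t ×ˢ ball x₀ R) := measurableSet_Ioo.prod measurableSet_ball
  -- pointwise bound on the strip
  have hpt : ∀ z ∈ Ioo (0 : ℝ) t ×ˢ (univ : Set (EuclideanSpace ℝ (Fin 3))),
      2⁻¹ * ‖u₁ z.1 z.2 - u₂ z.1 z.2‖ₑ ^ 2 *
          ‖⟪u₁ z.1 z.2 - u₂ z.1 z.2, gradient (fun x => φ (x - x₀)) z.2⟫‖ₑ ≤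
        (Ioo (0 : ℝ) t ×ˢ ball x₀ R).indicator (fun z => ENNReal.ofReal (B / 2) * g z) z := by
    intro z hz
    by_cases hzR : z.2 ∈ ball x₀ R
    · rw [indicator_of_mem (show z ∈ Ioo (0 : ℝ) t ×ˢ ball x₀ R from ⟨hz.1, hzR⟩)]
      have hin : ‖⟪u₁ z.1 z.2 - u₂ z.1 z.2, gradient (fun x => φ (x - x₀)) z.2⟫‖ₑ ≤
          ‖u₁ z.1 z.2 - u₂ z.1 z.2‖ₑ * ENNReal.ofReal B := by
        rw [Real.enorm_eq_ofReal_abs, ← ofReal_norm, ← ENNReal.ofReal_mul (norm_nonneg _)]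
        refine ENNReal.ofReal_le_ofReal ((abs_real_inner_le_norm _ _).trans ?_)
        exact mul_le_mul_of_nonneg_left (hbd x₀ z.2).2.1 (norm_nonneg _)
      calc 2⁻¹ * ‖u₁ z.1 z.2 - u₂ z.1 z.2‖ₑ ^ 2 *
            ‖⟪u₁ z.1 z.2 - u₂ z.1 z.2, gradient (fun x => φ (x - x₀)) z.2⟫‖ₑ
          ≤ 2⁻¹ * ‖u₁ z.1 z.2 - u₂ z.1 z.2‖ₑ ^ 2 * (‖u₁ z.1 z.2 - u₂ z.1 z.2‖ₑ * ENNReal.ofReal B) :=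
            mul_le_mul_right hin _
        _ = ENNReal.ofReal (B / 2) * g z := by
            rw [show B / 2 = 2⁻¹ * B by ring, ENNReal.ofReal_mul (by norm_num : (0 : ℝ) ≤ 2⁻¹),
              ENNReal.ofReal_inv_of_pos two_pos, ENNReal.ofReal_ofNat]
            ring
    · have h0 : gradient (fun x => φ (x - x₀)) z.2 = 0 := ((hbd x₀ z.2).2.2.2 hzR).2.1
      rw [h0, inner_zero_right, enorm_zero, mul_zero]
      exact bot_le
  have hD : (⨆ y : (EuclideanSpace ℝ (Fin 3)), ∫⁻ z in Ioo 0 t ×ˢ ball y 1, g z) = ulocCubicOn t (u₁ - u₂) := by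
    simp only [ulocCubicOn, hg, Pi.sub_apply]
  calc ∫⁻ z in Ioo 0 t ×ˢ (univ : Set (EuclideanSpace ℝ (Fin 3))), 2⁻¹ * ‖u₁ z.1 z.2 - u₂ z.1 z.2‖ₑ ^ 2 *
          ‖⟪u₁ z.1 z.2 - u₂ z.1 z.2, gradient (fun x => φ (x - x₀)) z.2⟫‖ₑ
      ≤ ∫⁻ z in Ioo 0 t ×ˢ (univ : Set (EuclideanSpace ℝ (Fin 3))),
          (Ioo (0 : ℝ) t ×ˢ ball x₀ R).indicator (fun z => ENNReal.ofReal (B / 2) * g z) z :=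
        setLIntegral_mono' (measurableSet_Ioo.prod MeasurableSet.univ) hpt
    _ = ∫⁻ z in Ioo 0 t ×ˢ ball x₀ R, ENNReal.ofReal (B / 2) * g z := by
        rw [lintegral_indicator hmeas, Measure.restrict_restrict hmeas,
          inter_eq_left.2 (prod_mono Subset.rfl (subset_univ _))]
    _ = ENNReal.ofReal (B / 2) * ∫⁻ z in Ioo 0 t ×ˢ ball x₀ R, g z :=
        lintegral_const_mul' _ _ ENNReal.ofReal_ne_top
    _ ≤ ENNReal.ofReal (B / 2) * (N * ⨆ y : (EuclideanSpace ℝ (Fin 3)), ∫⁻ z in Ioo 0 t ×ˢ ball y 1, g z) :=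
        mul_le_mul_right (hN volume (Ioo 0 t) g x₀) _
    _ = ENNReal.ofReal (B / 2 * N) * ulocCubicOn t (u₁ - u₂) := by
        rw [hD, ENNReal.ofReal_mul (by positivity : (0 : ℝ) ≤ B / 2), ENNReal.ofReal_coe_nnreal]
        ring

/-! ## The assembly of U₁ᵦ -/

/-- The six-term bookkeeping: summing the individual estimates and enlarging the constants
(pure semiring algebra with monotonicity). [folklore] -/
theorem ennreal_six_term_bound {T₁ T₂ T₃ T₄ T₅ T₆ ν' I D J₁ P e ΓI C₁ C₂ CP CN C : ℝ≥0∞}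
    (h1 : T₁ ≤ ν' * C₁ * I) (h2 : T₂ ≤ CP * (D + J₁) + CP * e * ΓI)
    (h3 : T₃ ≤ CN * (J₁ + e * ΓI)) (h4 : T₄ ≤ C₂ * D) (h5 : T₅ ≤ CN * (J₁ + e * ΓI))
    (h6 : T₆ ≤ CN * (P + e * ΓI)) (hC₁ : C₁ ≤ C) (hD : CP + C₂ ≤ C) (hJ : CP + CN + CN ≤ C)
    (hP : CN ≤ C) (he : CP + CN + CN + CN ≤ C) :
    T₁ + T₂ + T₃ + T₄ + T₅ + T₆ ≤ C * (ν' * I + D + J₁ + P) + C * e * ΓI :=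
  calc T₁ + T₂ + T₃ + T₄ + T₅ + T₆
      ≤ ν' * C₁ * I + (CP * (D + J₁) + CP * e * ΓI) + CN * (J₁ + e * ΓI) + C₂ * D +
          CN * (J₁ + e * ΓI) + CN * (P + e * ΓI) :=
        add_le_add (add_le_add (add_le_add (add_le_add (add_le_add h1 h2) h3) h4) h5) h6
    _ = C₁ * (ν' * I) + (CP + C₂) * D + (CP + CN + CN) * J₁ + CN * P +
          (CP + CN + CN + CN) * (e * ΓI) := by ring
    _ ≤ C * (ν' * I) + C * D + C * J₁ + C * P + C * (e * ΓI) := by gcongr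
    _ = C * (ν' * I + D + J₁ + P) + C * e * ΓI := by ring

/-- **The right-hand estimate (part 2) from the pressure estimate and the transport
estimates** (Lemarié-Rieusset 2016, proof of Thm. 14.7, file p. 517): the six terms of
`differenceEnergyRHS` for the translate `φ(· - x₀)` are bounded by the two proved elementary
estimates (`exists_laplacianTerm_le`, `exists_cubicTerm_le`), the pressure estimate `hP`
("`∫₀ᵗ∫(w·∇φ)(R₁ + R₂) ≤ Cδ(t)³`", "`∫₀ᵗ∫(w·∇φ)(S₁ + S₂) ≤ C∫₀ᵗ‖u₃‖_∞α² +
C‖u₄‖γ(γ² + ∫₀ᵗα²)^{1/2}`", pp. 516–517, with the local pressure expansion of local Leray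
solutions, Kang–Miura–Tsai 2021, Lemma 3.4) and the three transport estimates `hN` (p. 517,
fourth, sixth and seventh estimates); summing gives part 2 with the constant
`C(φ) = C_Δ + C_cub + C_P + 3C_N + 1`. [cite: LemarieRieusset2016, Thm. 14.7, proof (file p. 517)] -/
theorem local_leray_difference_rhs_estimate_of
    (hP : ∀ φ : (EuclideanSpace ℝ (Fin 3)) → ℝ, FunctionSpaces.IsTestFunctionOn (⊤ : Opens (EuclideanSpace ℝ (Fin 3))) φ → ∃ C : ℝ, 0 < C ∧
        ∀ {ν T : ℝ} {u₀ : (EuclideanSpace ℝ (Fin 3)) → (EuclideanSpace ℝ (Fin 3))} {u₁ u₂ : ℝ → (EuclideanSpace ℝ (Fin 3)) → (EuclideanSpace ℝ (Fin 3))} {p₁ p₂ : ℝ → (EuclideanSpace ℝ (Fin 3)) → ℝ}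
          {u₃ u₄ : ℝ → (EuclideanSpace ℝ (Fin 3)) → (EuclideanSpace ℝ (Fin 3))} {m : ℝ → ℝ} {ε : ℝ} {G₁ G₂ : ℝ → (EuclideanSpace ℝ (Fin 3)) → (EuclideanSpace ℝ (Fin 3)) →L[ℝ] (EuclideanSpace ℝ (Fin 3))},
          LemarieRieusset2016.WeakStrongSetting ν T u₀ u₁ u₂ p₁ p₂ u₃ u₄ m ε G₁ G₂ →
          ∀ (x₀ : (EuclideanSpace ℝ (Fin 3))) (t : ℝ), t ∈ Ioc 0 T →
            ‖∫ z in Ioo 0 t ×ˢ (univ : Set (EuclideanSpace ℝ (Fin 3))),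
                (p₁ z.1 z.2 - p₂ z.1 z.2) * ⟪u₁ z.1 z.2 - u₂ z.1 z.2, gradient (fun x => φ (x - x₀)) z.2⟫‖ₑ ≤
              ENNReal.ofReal C *
                  (ulocCubicOn t (u₁ - u₂) +
                    ∫⁻ s in Ioo 0 t, ENNReal.ofReal (m s) * ulocEnergy (u₁ s - u₂ s)) +
                ENNReal.ofReal C * ENNReal.ofReal ε *
                  (ulocGradEnergyOn t (G₁ - G₂) + ∫⁻ s in Ioo 0 t, ulocEnergy (u₁ s - u₂ s)))
    (hN : ∀ φ : (EuclideanSpace ℝ (Fin 3)) → ℝ, FunctionSpaces.IsTestFunctionOn (⊤ : Opens (EuclideanSpace ℝ (Fin 3))) φ → ∃ C : ℝ, 0 < C ∧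
        ∀ {ν T : ℝ} {u₀ : (EuclideanSpace ℝ (Fin 3)) → (EuclideanSpace ℝ (Fin 3))} {u₁ u₂ : ℝ → (EuclideanSpace ℝ (Fin 3)) → (EuclideanSpace ℝ (Fin 3))} {p₁ p₂ : ℝ → (EuclideanSpace ℝ (Fin 3)) → ℝ}
          {u₃ u₄ : ℝ → (EuclideanSpace ℝ (Fin 3)) → (EuclideanSpace ℝ (Fin 3))} {m : ℝ → ℝ} {ε : ℝ} {G₁ G₂ : ℝ → (EuclideanSpace ℝ (Fin 3)) → (EuclideanSpace ℝ (Fin 3)) →L[ℝ] (EuclideanSpace ℝ (Fin 3))},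
          LemarieRieusset2016.WeakStrongSetting ν T u₀ u₁ u₂ p₁ p₂ u₃ u₄ m ε G₁ G₂ →
          ∀ (x₀ : (EuclideanSpace ℝ (Fin 3))) (t : ℝ), t ∈ Ioc 0 T →
            (∫⁻ z in Ioo 0 t ×ˢ (univ : Set (EuclideanSpace ℝ (Fin 3))),
                ‖⟪u₁ z.1 z.2, u₁ z.1 z.2 - u₂ z.1 z.2⟫‖ₑ *
                  ‖⟪u₁ z.1 z.2 - u₂ z.1 z.2, gradient (fun x => φ (x - x₀)) z.2⟫‖ₑ) ≤
              ENNReal.ofReal C *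
                ((∫⁻ s in Ioo 0 t, ENNReal.ofReal (m s) * ulocEnergy (u₁ s - u₂ s)) +
                  ENNReal.ofReal ε *
                    (ulocGradEnergyOn t (G₁ - G₂) + ∫⁻ s in Ioo 0 t, ulocEnergy (u₁ s - u₂ s))) ∧
            (∫⁻ z in Ioo 0 t ×ˢ (univ : Set (EuclideanSpace ℝ (Fin 3))),
                2⁻¹ * ‖u₁ z.1 z.2 - u₂ z.1 z.2‖ₑ ^ 2 *
                  ‖⟪u₁ z.1 z.2, gradient (fun x => φ (x - x₀)) z.2⟫‖ₑ) ≤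
              ENNReal.ofReal C *
                ((∫⁻ s in Ioo 0 t, ENNReal.ofReal (m s) * ulocEnergy (u₁ s - u₂ s)) +
                  ENNReal.ofReal ε *
                    (ulocGradEnergyOn t (G₁ - G₂) + ∫⁻ s in Ioo 0 t, ulocEnergy (u₁ s - u₂ s))) ∧
            (∫⁻ z in Ioo 0 t ×ˢ (univ : Set (EuclideanSpace ℝ (Fin 3))),
                ENNReal.ofReal (φ (z.2 - x₀)) *
                  ‖⟪u₁ z.1 z.2, (G₁ z.1 z.2 - G₂ z.1 z.2) (u₁ z.1 z.2 - u₂ z.1 z.2)⟫‖ₑ) ≤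
              ENNReal.ofReal C *
                (ulocGradEnergyOn t (G₁ - G₂) ^ (1 / 2 : ℝ) *
                    (∫⁻ s in Ioo 0 t, ENNReal.ofReal (m s ^ 2) * ulocEnergy (u₁ s - u₂ s)) ^ (1 / 2 : ℝ) +
                  ENNReal.ofReal ε *
                    (ulocGradEnergyOn t (G₁ - G₂) + ∫⁻ s in Ioo 0 t, ulocEnergy (u₁ s - u₂ s)))) :
    ∀ φ : (EuclideanSpace ℝ (Fin 3)) → ℝ, FunctionSpaces.IsTestFunctionOn (⊤ : Opens (EuclideanSpace ℝ (Fin 3))) φ → ∃ C : ℝ, 0 < C ∧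
      ∀ {ν T : ℝ} {u₀ : (EuclideanSpace ℝ (Fin 3)) → (EuclideanSpace ℝ (Fin 3))} {u₁ u₂ : ℝ → (EuclideanSpace ℝ (Fin 3)) → (EuclideanSpace ℝ (Fin 3))} {p₁ p₂ : ℝ → (EuclideanSpace ℝ (Fin 3)) → ℝ}
        {u₃ u₄ : ℝ → (EuclideanSpace ℝ (Fin 3)) → (EuclideanSpace ℝ (Fin 3))} {m : ℝ → ℝ} {ε : ℝ} {G₁ G₂ : ℝ → (EuclideanSpace ℝ (Fin 3)) → (EuclideanSpace ℝ (Fin 3)) →L[ℝ] (EuclideanSpace ℝ (Fin 3))},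
        LemarieRieusset2016.WeakStrongSetting ν T u₀ u₁ u₂ p₁ p₂ u₃ u₄ m ε G₁ G₂ →
        ∀ (x₀ : (EuclideanSpace ℝ (Fin 3))) (t : ℝ), t ∈ Ioc 0 T →
          differenceEnergyRHS ν t u₁ u₂ p₁ p₂ G₁ G₂ (fun x => φ (x - x₀)) ≤
            ENNReal.ofReal C *
                (ENNReal.ofReal ν * (∫⁻ s in Ioo 0 t, ulocEnergy (u₁ s - u₂ s)) +
                  ulocCubicOn t (u₁ - u₂) +
                  (∫⁻ s in Ioo 0 t, ENNReal.ofReal (m s) * ulocEnergy (u₁ s - u₂ s)) +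
                  ulocGradEnergyOn t (G₁ - G₂) ^ (1 / 2 : ℝ) *
                    (∫⁻ s in Ioo 0 t, ENNReal.ofReal (m s ^ 2) * ulocEnergy (u₁ s - u₂ s)) ^
                      (1 / 2 : ℝ)) +
              ENNReal.ofReal C * ENNReal.ofReal ε *
                (ulocGradEnergyOn t (G₁ - G₂) + ∫⁻ s in Ioo 0 t, ulocEnergy (u₁ s - u₂ s)) := by
  intro φ hφ
  obtain ⟨C₁, hC₁, h1⟩ := exists_laplacianTerm_le hφ
  obtain ⟨C₂, hC₂, h2⟩ := exists_cubicTerm_le hφ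
  obtain ⟨CP, hCP, hP'⟩ := hP φ hφ
  obtain ⟨CN, hCN, hN'⟩ := hN φ hφ
  refine ⟨C₁ + C₂ + CP + 3 * CN + 1, by positivity, ?_⟩
  intro ν T u₀ u₁ u₂ p₁ p₂ u₃ u₄ m ε G₁ G₂ hS x₀ t ht
  have a := h1 hS x₀ t ht
  have b := hP' hS x₀ t ht
  obtain ⟨c, d, e⟩ := hN' hS x₀ t ht
  have f := h2 hS x₀ t ht
  -- constants in `ℝ≥0∞`
  set C : ℝ := C₁ + C₂ + CP + 3 * CN + 1 with hCdef
  have hc1 : ENNReal.ofReal C₁ ≤ ENNReal.ofReal C := ENNReal.ofReal_le_ofReal (by linarith)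
  have hcD : ENNReal.ofReal CP + ENNReal.ofReal C₂ ≤ ENNReal.ofReal C := by
    rw [← ENNReal.ofReal_add hCP.le hC₂]
    exact ENNReal.ofReal_le_ofReal (by linarith)
  have hcJ : ENNReal.ofReal CP + ENNReal.ofReal CN + ENNReal.ofReal CN ≤ ENNReal.ofReal C := by
    rw [← ENNReal.ofReal_add hCP.le hCN.le, ← ENNReal.ofReal_add (by positivity) hCN.le]
    exact ENNReal.ofReal_le_ofReal (by linarith)
  have hcP : ENNReal.ofReal CN ≤ ENNReal.ofReal C := ENNReal.ofReal_le_ofReal (by linarith)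
  have hce : ENNReal.ofReal CP + ENNReal.ofReal CN + ENNReal.ofReal CN + ENNReal.ofReal CN ≤
      ENNReal.ofReal C := by
    rw [← ENNReal.ofReal_add hCP.le hCN.le, ← ENNReal.ofReal_add (by positivity) hCN.le,
      ← ENNReal.ofReal_add (by positivity) hCN.le]
    exact ENNReal.ofReal_le_ofReal (by linarith)
  simp only [differenceEnergyRHS]
  have a' : ∫⁻ z in Ioo 0 t ×ˢ (univ : Set (EuclideanSpace ℝ (Fin 3))),
      ENNReal.ofReal (ν / 2) * ‖(Δ fun x => φ (x - x₀)) z.2‖ₑ * ‖u₁ z.1 z.2 - u₂ z.1 z.2‖ₑ ^ 2 ≤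
      ENNReal.ofReal ν * ENNReal.ofReal C₁ * ∫⁻ s in Ioo 0 t, ulocEnergy (u₁ s - u₂ s) := a
  exact ennreal_six_term_bound a' b c f d e hc1 hcD hcJ hcP hce


/-- **U₁ from the tested inequality, the pressure estimate and the transport estimates**: the
composition of `local_leray_difference_energy_estimate_of` (second layer) with
`local_leray_difference_rhs_estimate_of`. After this theorem the unproved inputs of **U₁**
(hence of **U**, by `local_leray_weak_strong_uniqueness_of`) are exactly: part 1 (the tested
local energy inequality for the difference, pp. 515–516), the pressure estimate (pp. 516–517)
and the transport estimates (p. 517), all stated inline. [cite: LemarieRieusset2016, Thm. 14.7, proof (file pp. 515–517)] -/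
theorem local_leray_difference_energy_estimate_of_pressure_transport
    (hA : ∀ {ν T : ℝ} {u₀ : (EuclideanSpace ℝ (Fin 3)) → (EuclideanSpace ℝ (Fin 3))} {u₁ u₂ : ℝ → (EuclideanSpace ℝ (Fin 3)) → (EuclideanSpace ℝ (Fin 3))} {p₁ p₂ : ℝ → (EuclideanSpace ℝ (Fin 3)) → ℝ}
      {u₃ u₄ : ℝ → (EuclideanSpace ℝ (Fin 3)) → (EuclideanSpace ℝ (Fin 3))} {m : ℝ → ℝ} {ε : ℝ} {G₁ G₂ : ℝ → (EuclideanSpace ℝ (Fin 3)) → (EuclideanSpace ℝ (Fin 3)) →L[ℝ] (EuclideanSpace ℝ (Fin 3))},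
      LemarieRieusset2016.WeakStrongSetting ν T u₀ u₁ u₂ p₁ p₂ u₃ u₄ m ε G₁ G₂ →
      ∀ᵐ t ∂(volume.restrict (Ioo 0 T)), ∀ φ : (EuclideanSpace ℝ (Fin 3)) → ℝ,
        FunctionSpaces.IsTestFunctionOn (⊤ : Opens (EuclideanSpace ℝ (Fin 3))) φ → (∀ x, 0 ≤ φ x) →
        2⁻¹ * weightedEnergy φ (u₁ t - u₂ t) +
            ENNReal.ofReal ν * weightedGradEnergyOn t φ (G₁ - G₂) ≤
          differenceEnergyRHS ν t u₁ u₂ p₁ p₂ G₁ G₂ φ)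
    (hP : ∀ φ : (EuclideanSpace ℝ (Fin 3)) → ℝ, FunctionSpaces.IsTestFunctionOn (⊤ : Opens (EuclideanSpace ℝ (Fin 3))) φ → ∃ C : ℝ, 0 < C ∧
        ∀ {ν T : ℝ} {u₀ : (EuclideanSpace ℝ (Fin 3)) → (EuclideanSpace ℝ (Fin 3))} {u₁ u₂ : ℝ → (EuclideanSpace ℝ (Fin 3)) → (EuclideanSpace ℝ (Fin 3))} {p₁ p₂ : ℝ → (EuclideanSpace ℝ (Fin 3)) → ℝ}
          {u₃ u₄ : ℝ → (EuclideanSpace ℝ (Fin 3)) → (EuclideanSpace ℝ (Fin 3))} {m : ℝ → ℝ} {ε : ℝ} {G₁ G₂ : ℝ → (EuclideanSpace ℝ (Fin 3)) → (EuclideanSpace ℝ (Fin 3)) →L[ℝ] (EuclideanSpace ℝ (Fin 3))},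
          LemarieRieusset2016.WeakStrongSetting ν T u₀ u₁ u₂ p₁ p₂ u₃ u₄ m ε G₁ G₂ →
          ∀ (x₀ : (EuclideanSpace ℝ (Fin 3))) (t : ℝ), t ∈ Ioc 0 T →
            ‖∫ z in Ioo 0 t ×ˢ (univ : Set (EuclideanSpace ℝ (Fin 3))),
                (p₁ z.1 z.2 - p₂ z.1 z.2) * ⟪u₁ z.1 z.2 - u₂ z.1 z.2, gradient (fun x => φ (x - x₀)) z.2⟫‖ₑ ≤
              ENNReal.ofReal C *
                  (ulocCubicOn t (u₁ - u₂) +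
                    ∫⁻ s in Ioo 0 t, ENNReal.ofReal (m s) * ulocEnergy (u₁ s - u₂ s)) +
                ENNReal.ofReal C * ENNReal.ofReal ε *
                  (ulocGradEnergyOn t (G₁ - G₂) + ∫⁻ s in Ioo 0 t, ulocEnergy (u₁ s - u₂ s)))
    (hN : ∀ φ : (EuclideanSpace ℝ (Fin 3)) → ℝ, FunctionSpaces.IsTestFunctionOn (⊤ : Opens (EuclideanSpace ℝ (Fin 3))) φ → ∃ C : ℝ, 0 < C ∧
        ∀ {ν T : ℝ} {u₀ : (EuclideanSpace ℝ (Fin 3)) → (EuclideanSpace ℝ (Fin 3))} {u₁ u₂ : ℝ → (EuclideanSpace ℝ (Fin 3)) → (EuclideanSpace ℝ (Fin 3))} {p₁ p₂ : ℝ → (EuclideanSpace ℝ (Fin 3)) → ℝ}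
          {u₃ u₄ : ℝ → (EuclideanSpace ℝ (Fin 3)) → (EuclideanSpace ℝ (Fin 3))} {m : ℝ → ℝ} {ε : ℝ} {G₁ G₂ : ℝ → (EuclideanSpace ℝ (Fin 3)) → (EuclideanSpace ℝ (Fin 3)) →L[ℝ] (EuclideanSpace ℝ (Fin 3))},
          LemarieRieusset2016.WeakStrongSetting ν T u₀ u₁ u₂ p₁ p₂ u₃ u₄ m ε G₁ G₂ →
          ∀ (x₀ : (EuclideanSpace ℝ (Fin 3))) (t : ℝ), t ∈ Ioc 0 T →
            (∫⁻ z in Ioo 0 t ×ˢ (univ : Set (EuclideanSpace ℝ (Fin 3))),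
                ‖⟪u₁ z.1 z.2, u₁ z.1 z.2 - u₂ z.1 z.2⟫‖ₑ *
                  ‖⟪u₁ z.1 z.2 - u₂ z.1 z.2, gradient (fun x => φ (x - x₀)) z.2⟫‖ₑ) ≤
              ENNReal.ofReal C *
                ((∫⁻ s in Ioo 0 t, ENNReal.ofReal (m s) * ulocEnergy (u₁ s - u₂ s)) +
                  ENNReal.ofReal ε *
                    (ulocGradEnergyOn t (G₁ - G₂) + ∫⁻ s in Ioo 0 t, ulocEnergy (u₁ s - u₂ s))) ∧
            (∫⁻ z in Ioo 0 t ×ˢ (univ : Set (EuclideanSpace ℝ (Fin 3))),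
                2⁻¹ * ‖u₁ z.1 z.2 - u₂ z.1 z.2‖ₑ ^ 2 *
                  ‖⟪u₁ z.1 z.2, gradient (fun x => φ (x - x₀)) z.2⟫‖ₑ) ≤
              ENNReal.ofReal C *
                ((∫⁻ s in Ioo 0 t, ENNReal.ofReal (m s) * ulocEnergy (u₁ s - u₂ s)) +
                  ENNReal.ofReal ε *
                    (ulocGradEnergyOn t (G₁ - G₂) + ∫⁻ s in Ioo 0 t, ulocEnergy (u₁ s - u₂ s))) ∧
            (∫⁻ z in Ioo 0 t ×ˢ (univ : Set (EuclideanSpace ℝ (Fin 3))),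
                ENNReal.ofReal (φ (z.2 - x₀)) *
                  ‖⟪u₁ z.1 z.2, (G₁ z.1 z.2 - G₂ z.1 z.2) (u₁ z.1 z.2 - u₂ z.1 z.2)⟫‖ₑ) ≤
              ENNReal.ofReal C *
                (ulocGradEnergyOn t (G₁ - G₂) ^ (1 / 2 : ℝ) *
                    (∫⁻ s in Ioo 0 t, ENNReal.ofReal (m s ^ 2) * ulocEnergy (u₁ s - u₂ s)) ^ (1 / 2 : ℝ) +
                  ENNReal.ofReal ε *
                    (ulocGradEnergyOn t (G₁ - G₂) + ∫⁻ s in Ioo 0 t, ulocEnergy (u₁ s - u₂ s)))) :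
    local_leray_difference_energy_estimate :=
  local_leray_difference_energy_estimate_of hA (local_leray_difference_rhs_estimate_of hP hN)

end Literature.Analysis.FluidPDE
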